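import Summits.QuantumFields.YangMills.Theorems.ParabolicTrajectoryContinuumLimitOnTrajectoryDefsG
import Summits.QuantumFields.YangMills.Theorems.ParabolicTrajectoryLatticeGapOnTrajectorySplitDefs

/-!
# Route `ParabolicTrajectory`, crux `ContinuumLimitOnTrajectory` (stmt-QuantumFields-10522): the two crux chains' repairs RECONCILED (seat c5)

Proof file of line `two-orbit-synchronisation` (lead `prover-line-stmt-QuantumFields-10522-c5-0`, seat c5). The line leads of
crux (A) (this chain, seats c2–c5: `…DefsF`/`…DefsG`) and of crux (B) `LatticeGapOnTrajectory` (stmt-QuantumFields-10523, seats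
-0 … c3: `…LatticeGapOnTrajectorySplitDefs`, `Cruxes/LatticeGapOnTrajectory/RestatementC2.lean`) recommend restatements of the
route that do NOT compose as written:
* volume: (A) needs polynomial volume growth `PolyVolumeGrowth sch` (`∃ N ≥ 1, ∀ᶠ k, a_k⁻¹ ≤ (a_k L_k)^N`, torus seam of the
  smearing box), (B) needs `sch.HasVolumeGrowth` (`a_k L_k / log a_k⁻¹ → ∞`, thermal terms);
* transfer: the repaired (B) `Split.LatticeGapOnTrajectoryRV` transfers the gap only to witnesses `sch'` that are
  REFLECTION-SYMMETRIC with polynomially bounded renormalisations, while every (A) line outputs the canonical ONE-FIELD witness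
  `canon r sch` (`c = a⁻⁴` on `tr F²`, `0` on every other species — in particular on the time-reflected corner density, a different species for
  non-trivial `r.ρ`, so `canon r sch` is NOT reflection-symmetric) and instead delivers the continuum gap of ITS OWN witness from its Cauchy–Schwarz
  clustering input (`ContinuumLimitWithGapPVG`, `…DefsF`; closed modulo `ChartExists`/`IRPhysicsCS`/`UVPhysics345` by
  `…ReductionPVG.continuumLimitWithGapPVG_of_inputs`).
This file proves the deciding theorems of the route in the currency in which both chains' LANDED reductions apply:
* §1 `hasVolumeGrowth_of_polyVolumeGrowth` — ONE volume clause suffices: `PolyVolumeGrowth sch → sch.HasVolumeGrowth`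
  (so (S) restated as `TunedSequenceExistsPVG` serves both (A_PVG) and the repaired (B));
* §2 `yangMills_of_gapCurrency : ContinuumLimitWithGapPVG → Split.LatticeGapOnTrajectoryLat → TunedSequenceExistsPVG → YangMills`
  — (A) in gap currency + (B) PURE LATTICE (`∃ Δ > 0, HasLatticeMassGap ∧ UniformSlabClustering`, the (B) line's Sub₁, closed
  modulo its one physics stub) + (S_PVG) ⇒ the sub-problem, with NO transfer clause, NO reflection symmetry, NO Müntz
  obstruction: the two gaps are glued at `min Δ Δ₁` (both clauses antitone);
  `yangMills_of_gapCurrencyRV` — the same with the (B) chain's 1:1 restatement `Split.LatticeGapOnTrajectoryRV` (only its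
  lattice clause is used; its volume hypothesis is fed by §1);
* §3 `yangMills_of_allInputs` — the WHOLE ROUTE modulo exactly five named statements: `ChartExists`, `IRPhysicsCS`,
  `UVPhysics345` ((A) side), the orbit–Kantorovich windows along tuned schemes (`Split.OrbitKRWindowsAlongP`, the (B) line's
  physics stub) and `TunedSequenceExistsPVG` ((S) with the volume clause).
Refs: `…DefsF`, `…DefsG`, `…ReductionPVG`; `…LatticeGapOnTrajectorySplitDefs` §§1–5; JaffeWitten2000 §4; GlimmJaffe1987 §19.7.
-/

set_option autoImplicit false

open scoped SchwartzMap
open MeasureTheory Filter Topology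
open Literature.MathematicalPhysics.QuantumFieldTheory Literature.MathematicalPhysics.QuantumLattice
open Literature.MathematicalPhysics.AQFT Literature.Probability.LatticeModels
open Summit.QuantumFields.YangMills.Theses.ParabolicTrajectory
open Summit.QuantumFields.YangMills.Cruxes.LatticeGapOnTrajectory.OrbitKantorovichFiniteSize

noncomputable section

namespace Summit.QuantumFields.YangMills.Cruxes.ContinuumLimitOnTrajectory.TwoOrbitSynchronisation

/-! ## §1 One volume clause: polynomial volume growth implies the (B) chain's `HasVolumeGrowth` -/

/-- **Polynomial volume growth implies the (B) chain's volume clause** `a_k L_k / log a_k⁻¹ → ∞`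
(`SpeciesScheme.HasVolumeGrowth`): from `a_k⁻¹ ≤ (a_k L_k)^N` eventually, `a_k L_k ≥ (a_k⁻¹)^{1/N}`, and
`x^{1/N}/log x → ∞` along `x = a_k⁻¹ → ∞` (`a_k → 0⁺`). Hence ONE clause — the one (A) needs — in the conclusion of the
restated (S) serves both (A_PVG) and the repaired (B). -/
theorem hasVolumeGrowth_of_polyVolumeGrowth {ι : Type} (sch : SpeciesScheme ι) (h : PolyVolumeGrowth sch) :
    sch.HasVolumeGrowth := by
  obtain ⟨N, hN, hev⟩ := h
  have hNpos : (0 : ℝ) < N := by exact_mod_cast hN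
  have hr : (0 : ℝ) < (N : ℝ)⁻¹ := inv_pos.2 hNpos
  -- `x_k = a_k⁻¹ → +∞`
  have hx : Tendsto (fun k => (sch.a k)⁻¹) atTop atTop := by
    refine tendsto_inv_nhdsGT_zero.comp (tendsto_nhdsWithin_iff.2 ⟨sch.tendsto_a, ?_⟩)
    exact Eventually.of_forall fun k => sch.a_pos k
  -- comparison `x_k^{1/N} / log x_k ≤ a_k L_k / log a_k⁻¹` eventually
  have hcmp : ∀ᶠ k in atTop, ((sch.a k)⁻¹) ^ (N : ℝ)⁻¹ / Real.log (sch.a k)⁻¹ ≤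
      sch.a k * sch.L k / Real.log (sch.a k)⁻¹ := by
    filter_upwards [hev, hx.eventually (eventually_gt_atTop (1 : ℝ))] with k hk hk1
    have hlog : 0 < Real.log (sch.a k)⁻¹ := Real.log_pos hk1
    refine div_le_div_of_nonneg_right ?_ hlog.le
    have hℓ : 0 ≤ sch.a k * sch.L k := mul_nonneg (sch.a_pos k).le (Nat.cast_nonneg _)
    have hx0 : 0 ≤ (sch.a k)⁻¹ := (inv_pos.2 (sch.a_pos k)).le
    calc ((sch.a k)⁻¹) ^ (N : ℝ)⁻¹ ≤ ((sch.a k * sch.L k) ^ N) ^ (N : ℝ)⁻¹ :=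
          Real.rpow_le_rpow hx0 hk hr.le
      _ = sch.a k * sch.L k := by
          rw [← Real.rpow_natCast, ← Real.rpow_mul hℓ, mul_inv_cancel₀ hNpos.ne', Real.rpow_one]
  -- `x^{1/N} / log x → +∞` along `x → +∞` (Mathlib: `log =o(x^r)`; the same three lines prove the tree's
  -- `Literature.NumberTheory.Sieve.Lichtman2020.tendsto_rpow_div_log_atTop`, not imported here to keep the cone in QFT)
  have hreal : Tendsto (fun x : ℝ => x ^ (N : ℝ)⁻¹ / Real.log x) atTop atTop := by
    have h0 : Tendsto (fun x : ℝ => Real.log x / x ^ (N : ℝ)⁻¹) atTop (𝓝 0) :=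
      (isLittleO_log_rpow_atTop hr).tendsto_div_nhds_zero
    have hpos : ∀ᶠ x : ℝ in atTop, 0 < Real.log x / x ^ (N : ℝ)⁻¹ := by
      filter_upwards [eventually_gt_atTop (1 : ℝ)] with x hx1
      exact div_pos (Real.log_pos hx1) (Real.rpow_pos_of_pos (by linarith) _)
    have h1 : Tendsto (fun x : ℝ => Real.log x / x ^ (N : ℝ)⁻¹) atTop (𝓝[>] 0) :=
      tendsto_nhdsWithin_iff.2 ⟨h0, hpos⟩
    refine (tendsto_inv_nhdsGT_zero.comp h1).congr' (Eventually.of_forall fun x => ?_)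
    simp [Function.comp, inv_div]
  exact tendsto_atTop_mono' atTop hcmp (hreal.comp hx)

/-! ## §2 The reconciled deciding theorems: (A) in gap currency, (B) pure lattice, (S) with the volume clause -/

/-- **`(A_gap,PVG) → (B_lattice) → (S_PVG) → YangMills`, no transfer clause.** Fix `G`; `IsCompactSimpleLieGroup G` gives `r`;
take `M = max M₀ 2` and `θ₀` from `ContinuumLimitWithGapPVG`, `θ₁` from (S_PVG), `θ = min θ₀ θ₁ / 2`; (S_PVG) gives a tuned
`M`-adic weak-coupling scheme `sch` WITH polynomial volume growth; (B_lattice) (`Split.LatticeGapOnTrajectoryLat`, the (B)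
line's Sub₁) gives `Δ > 0` and `HasLatticeMassGap r sch Δ` (its slab-clustering conjunct is not even needed here); (A) in gap
currency gives the witness `sch'` (same `a, β, L`), `T`, and `Δ₁ > 0` with `T.HasMassGap Δ₁`; the sub-problem's gap is
`min Δ Δ₁` (both clauses antitone: `osData_hasMassGap_anti'`, `Split.hasLatticeMassGap_of_le`), the lattice clause rewritten
along `sch'.(a,β,L) = sch.(a,β,L)`, the weak-coupling conjunct transported along `sch'.β = sch.β`. -/
theorem yangMills_of_gapCurrency :
    ContinuumLimitWithGapPVG → Split.LatticeGapOnTrajectoryLat → TunedSequenceExistsPVG → YangMills := by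
  intro hA hB hS G _ _ _ _ hG
  obtain ⟨r⟩ := hG.2
  letI : MeasurableSpace G := borel G
  haveI : BorelSpace G := ⟨rfl⟩
  obtain ⟨M₀, hM₀⟩ := hA G hG r
  have hM2 : 2 ≤ max M₀ 2 := le_max_right _ _
  obtain ⟨θ₀, hθ₀, hA'⟩ := hM₀ (max M₀ 2) (le_max_left _ _) hM2
  obtain ⟨θ₁, hθ₁, hS'⟩ := hS G hG r (max M₀ 2) hM2
  have hθpos : 0 < min θ₀ θ₁ / 2 := by positivity
  have hθlt₀ : min θ₀ θ₁ / 2 < θ₀ := by have := min_le_left θ₀ θ₁; linarith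
  have hθlt₁ : min θ₀ θ₁ / 2 < θ₁ := by have := min_le_right θ₀ θ₁; linarith
  obtain ⟨sch, n, hshape, hbeta, hconv, htune, hgrowth⟩ := hS' (min θ₀ θ₁ / 2) hθpos hθlt₁
  obtain ⟨Δ, hΔ, hgap, -⟩ := hB G hG r (max M₀ 2) (min θ₀ θ₁ / 2) sch n hM2 hθpos hshape hbeta htune
  obtain ⟨sch', ha, hβ, hL, T, hYM, hNT, hNG, Δ₁, hΔ₁, hTgap⟩ :=
    hA' (min θ₀ θ₁ / 2) Δ sch n hθpos hθlt₀ hΔ hshape hbeta hconv htune hgap hgrowth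
  have hweak : sch'.HasWeakCouplingLimit := by
    show Tendsto sch'.β atTop atTop
    rw [hβ]
    exact hbeta
  have hgap' : HasLatticeMassGap r sch (min Δ Δ₁) := Split.hasLatticeMassGap_of_le r sch (min_le_left _ _) hgap
  refine ⟨r, sch', T, hweak, hYM, hNT, hNG, min Δ Δ₁, lt_min hΔ hΔ₁,
    osData_hasMassGap_anti' T (min_le_right _ _) hTgap, ?_⟩
  intro A B
  obtain ⟨C, hC⟩ := hgap' A B
  refine ⟨C, ?_⟩
  simpa only [ha, hβ, hL] using hC

/-- **The same with the (B) chain's 1:1 restatement `Split.LatticeGapOnTrajectoryRV`** ((B) + `HasVolumeGrowth` hypothesis,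
transfer restricted to reflection-symmetric witnesses): only its LATTICE clause is used — its transfer clause could not be
applied to the canonical one-field witness of the (A) lines, which is not reflection-symmetric — and its volume hypothesis is
supplied from the polynomial volume growth output by (S_PVG) (`hasVolumeGrowth_of_polyVolumeGrowth`). -/
theorem yangMills_of_gapCurrencyRV :
    ContinuumLimitWithGapPVG → Split.LatticeGapOnTrajectoryRV → TunedSequenceExistsPVG → YangMills := by
  intro hA hB hS G _ _ _ _ hG
  obtain ⟨r⟩ := hG.2
  letI : MeasurableSpace G := borel G
  haveI : BorelSpace G := ⟨rfl⟩
  obtain ⟨M₀, hM₀⟩ := hA G hG r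
  have hM2 : 2 ≤ max M₀ 2 := le_max_right _ _
  obtain ⟨θ₀, hθ₀, hA'⟩ := hM₀ (max M₀ 2) (le_max_left _ _) hM2
  obtain ⟨θ₁, hθ₁, hS'⟩ := hS G hG r (max M₀ 2) hM2
  have hθpos : 0 < min θ₀ θ₁ / 2 := by positivity
  have hθlt₀ : min θ₀ θ₁ / 2 < θ₀ := by have := min_le_left θ₀ θ₁; linarith
  have hθlt₁ : min θ₀ θ₁ / 2 < θ₁ := by have := min_le_right θ₀ θ₁; linarith
  obtain ⟨sch, n, hshape, hbeta, hconv, htune, hgrowth⟩ := hS' (min θ₀ θ₁ / 2) hθpos hθlt₁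
  have hvol : sch.HasVolumeGrowth := hasVolumeGrowth_of_polyVolumeGrowth sch hgrowth
  obtain ⟨Δ, hΔ, hgap, -⟩ := hB G hG r (max M₀ 2) (min θ₀ θ₁ / 2) sch n hM2 hθpos hshape hbeta hvol htune
  obtain ⟨sch', ha, hβ, hL, T, hYM, hNT, hNG, Δ₁, hΔ₁, hTgap⟩ :=
    hA' (min θ₀ θ₁ / 2) Δ sch n hθpos hθlt₀ hΔ hshape hbeta hconv htune hgap hgrowth
  have hweak : sch'.HasWeakCouplingLimit := by
    show Tendsto sch'.β atTop atTop
    rw [hβ]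
    exact hbeta
  have hgap' : HasLatticeMassGap r sch (min Δ Δ₁) := Split.hasLatticeMassGap_of_le r sch (min_le_left _ _) hgap
  refine ⟨r, sch', T, hweak, hYM, hNT, hNG, min Δ Δ₁, lt_min hΔ hΔ₁,
    osData_hasMassGap_anti' T (min_le_right _ _) hTgap, ?_⟩
  intro A B
  obtain ⟨C, hC⟩ := hgap' A B
  refine ⟨C, ?_⟩
  simpa only [ha, hβ, hL] using hC

/-! ## §3 The whole route modulo five named statements -/

/-- **Route `ParabolicTrajectory` modulo exactly five named statements.** The sub-problem `YangMills` follows from: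
`ChartExists` (the two-orbit chart — Bałaban's complete step along Wilson orbits), `IRPhysicsCS` (finite size at scale + CS
clustering of the canonical scheme), `UVPhysics345` (uniform-threshold plaquette-string bounds, one Pythagorean rotation,
non-degeneracy) — the three inputs of the (A) line, through `…ReductionPVG.continuumLimitWithGapPVG_of_inputs` —, the
orbit–Kantorovich windows along every tuned `M`-adic weak-coupling Wilson scheme (`Split.OrbitKRWindowsAlongP`, the (B)
line's one physics stub, through `Split.latticeGapOnTrajectoryLat_of_windowsP`), and the repaired (S) `TunedSequenceExistsPVG`.
No misstatement residue (`VolumeClause`, `Split.VolumeGrowthOnTrajectory`, `Split.SymmetrisationOnTrajectory`) remains. -/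
theorem yangMills_of_allInputs (hchart : ChartExists) (hir : IRPhysicsCS) (huv : UVPhysics345)
    (hW : ∀ (G : Type) [Group G] [TopologicalSpace G] [IsTopologicalGroup G] [CompactSpace G]
      [MeasurableSpace G] [BorelSpace G], IsCompactSimpleLieGroup G →
      ∀ (r : LatticeRep G) (M : ℕ) (θ : ℝ) (sch : SpeciesScheme (YMSpecies G)) (n : ℕ → ℕ),
        2 ≤ M → 0 < θ → (∀ k, sch.a k = ((M : ℝ) ^ n k)⁻¹) → Tendsto sch.β atTop atTop →
        Tendsto (fun k => ((M : ℝ) ^ n k) ^ 8 *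
            latticeConnectedCorr r.ρ (sch.β k) (sch.side k) r.curvature.F r.curvature.F (M ^ n k))
          atTop (𝓝 θ) → Split.OrbitKRWindowsAlongP r M sch n)
    (hS : TunedSequenceExistsPVG) : YangMills :=
  yangMills_of_gapCurrency (continuumLimitWithGapPVG_of_inputs hchart hir huv)
    (Split.latticeGapOnTrajectoryLat_of_windowsP hW) hS

end Summit.QuantumFields.YangMills.Cruxes.ContinuumLimitOnTrajectory.TwoOrbitSynchronisation

end
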